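import Summits.KontsevichZagierPeriods.Zeta5Search.LaiSweepShard

/-!
# `κ₃` sweep certificate — shard file 068 of 127 (shards 476–482 of 889)

HONEST FRAMING. Systematic search; no irrationality claim unless certified. This file only checks,
by `decide +kernel`, shards 476–482 of the order-cell sweep of the `κ₃` point `(74, 2180, 444; δ74)`
(engine `LaiSweepEngine`, soundness `LaiSweepJump/Free/Eval/Shard/Kappa3`; a shard is `⟨regime, n,
p, q, p', q', Lo, Up⟩`: `n` cells from `p/q` to `p'/q'` with integer rate sums in `[Lo, Up]`, `K =
128`, `D = 2^40`). It draws NO conclusion: only the capstone `LaiKappa3SweepCert`, which needs all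
127 shard files, does. Kernel cost of this file ≈ 560 cells × 0.3 s.
-/

namespace Summit.KontsevichZagierPeriods.Zeta5Search.Sweep

set_option maxHeartbeats 100000000 in
/-- Shard 476: 80 cells of regime B from `162/337` to `161/334`.
[cite: Lai2024BallRivoal, §4 Lemma 4.3] -/
theorem shard476 :
    Shard.check 128 (2^40)
      ⟨true, 80, 162, 337, 161, 334, 16274106515986, 19547306425897⟩ = true := by
  decide +kernel

set_option maxHeartbeats 100000000 in
/-- Shard 477: 80 cells of regime B from `161/334` to `188/389`.
[cite: Lai2024BallRivoal, §4 Lemma 4.3] -/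
theorem shard477 :
    Shard.check 128 (2^40)
      ⟨true, 80, 161, 334, 188, 389, 15377031645973, 18487180233198⟩ = true := by
  decide +kernel

set_option maxHeartbeats 100000000 in
/-- Shard 478: 80 cells of regime B from `188/389` to `47/97`.
[cite: Lai2024BallRivoal, §4 Lemma 4.3] -/
theorem shard478 :
    Shard.check 128 (2^40)
      ⟨true, 80, 188, 389, 47, 97, 15270599588243, 18376133522459⟩ = true := by
  decide +kernel

set_option maxHeartbeats 100000000 in
/-- Shard 479: 80 cells of regime B from `47/97` to `154/317`.
[cite: Lai2024BallRivoal, §4 Lemma 4.3] -/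
theorem shard479 :
    Shard.check 128 (2^40)
      ⟨true, 80, 47, 97, 154, 317, 15495026081303, 18663508234303⟩ = true := by
  decide +kernel

set_option maxHeartbeats 100000000 in
/-- Shard 480: 80 cells of regime B from `154/317` to `94/193`.
[cite: Lai2024BallRivoal, §4 Lemma 4.3] -/
theorem shard480 :
    Shard.check 128 (2^40)
      ⟨true, 80, 154, 317, 94, 193, 15180169722649, 18301078526343⟩ = true := by
  decide +kernel

set_option maxHeartbeats 100000000 in
/-- Shard 481: 80 cells of regime B from `94/193` to `167/342`.
[cite: Lai2024BallRivoal, §4 Lemma 4.3] -/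
theorem shard481 :
    Shard.check 128 (2^40)
      ⟨true, 80, 94, 193, 167, 342, 15310267100571, 18475040600841⟩ = true := by
  decide +kernel

set_option maxHeartbeats 100000000 in
/-- Shard 482: 80 cells of regime B from `167/342` to `164/335`.
[cite: Lai2024BallRivoal, §4 Lemma 4.3] -/
theorem shard482 :
    Shard.check 128 (2^40)
      ⟨true, 80, 167, 342, 164, 335, 15182411468894, 18337683938766⟩ = true := by
  decide +kernel

/-- The checked shards of this file, in order. [folklore] -/
def shards068 : List (CheckedShard 128 (2^40)) :=
  [⟨_, shard476⟩, ⟨_, shard477⟩, ⟨_, shard478⟩, ⟨_, shard479⟩, ⟨_, shard480⟩,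
    ⟨_, shard481⟩, ⟨_, shard482⟩]

end Summit.KontsevichZagierPeriods.Zeta5Search.Sweep
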